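import Literature.IUT.HodgeTheaters.InitialThetaDataTorsionCuspModelDelta
import HarnessLib

/-!
# [IUTchI] §1 p.37–38 at the group-ring two-step model: the CUSP SPAN `I_{ℤ·g}·U + Σ_{x ≠ ε⁰} 𝔽_l·ivec_x ⊆ U`, the
# one relation among the `l` cusp classes, and the total augmentation (NV-L5 row «JOINT-NV-CG (l cusps)», part B5b)

S. Mochizuki, *Inter-universal Teichmüller theory I*, kurims manuscript (May 2020), §1 p. 37: «`Δ_X̲ ↠ Δ_X̲^{ab} ⊗ (ℤ/lℤ)
↠ Δ_ε` for the quotient … by the images of the inertia groups of all nonzero cusps `≠ ε′, ε″` … a natural exact sequence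
`0 → I_{ε′} × I_{ε″} → Δ_ε → Δ_E ⊗ (ℤ/lℤ) → 0`» (so the `l` cusp classes of `X̲` satisfy ONE linear relation in
`Δ_X̲^{ab} ⊗ ℤ/l`), p. 38 l. 1 «`ι` acts on `Δ_E ⊗ (ℤ/lℤ)` via multiplication by `−1`».  [claim: Mochizuki2012, status:
disputed] (D-0012 claim key; series status DISPUTED — a MODEL of the cell's `π₁`-interface structures; nothing of the
series is asserted; no side taken on [IUTchIII] Cor. 3.12).

## WHAT (continuing part B5a `InitialThetaDataTorsionCuspModelDelta.lean`; `U = 𝔽_l[E_F[l]]`, `T = E_F[l]`, line `ℤ·g`)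

`U`-level linear algebra behind law (L3) of abc-iut-L5-t1's `ModLCuspLaws` at `pedOf₃`:
* **`cuspSpan g s h := cob g ⊔ ⨆_{x ≠ ε⁰} ⟨ivec_x⟩ ⊆ U`** — the `U`-part of `I_{ε′} · I_{ε″} · Ker(Δ_X̲ ↠ Δ_ε)`;
* **the ONE RELATION `prod_ivec_mem_cob`**: `Π_{x} ivec_x ∈ I_{ℤ·g}·U` (reindex the cusps by `· [h]`), hence `ivec_{ε⁰} ∈
  cuspSpan` too (`ivec_mem_cuspSpan`), every inertia vector `v_b` (`ivecAt_mem_cuspSpan`), every `e_{P a} · e_P⁻¹`, and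
  finally **`e_mul_inv_e_mem_cuspSpan`**: `e_P · e_Q⁻¹ ∈ cuspSpan` for ALL `P, Q` (`T = ⟨[a]⟩ · ℤ·g`);
* the TOTAL AUGMENTATION `ε(w) = Σ_P w(P)` (`totSum`, `eps`): `τ_t`-invariant, `ε((1,u)·w) = ε(u)·ε(w)`, vanishing on
  `cuspSpan`, and **`mem_cuspSpan_of_totSum_eq_zero`**: `ε(w) = 0 ⇒ w ∈ cuspSpan` (so `cuspSpan = Ker ε`, the augmentation
  kernel of `𝔽_l[E_F[l]]`: dimension `l² − 1 = (l² − l) + (l − 1)`).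

HONEST LABEL «[model; `E[l]`-twisted finite shadow `U ⋊ E[l]`; `l` cusps]»; no law is claimed in this file (part B5c).
Model ≠ genuine datum; typed ≠ proved; no side taken on [IUTchIII] Cor. 3.12.
-/

noncomputable section

namespace Literature.IUT.HodgeTheaters

universe u

namespace TorsionCuspModel
open Literature.AnabelianGeometry.AbsoluteAnabelian Topology TorsionMonodromyModel
open Literature.AnabelianGeometry.EtaleTheta.SettingModel
open scoped WeierstrassCurve.Affine Classical Pointwise

variable {F : Type u} [Field F] {E : WeierstrassCurve F} {Fbar : Type u} [Field Fbar] [Algebra F Fbar] {l : ℕ}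
  {g : Tors E Fbar l} (s : Tors E Fbar l ⧸ Subgroup.zpowers g → Tors E Fbar l) (h : Tors E Fbar l)

/-! ## The cusp span -/

/-- **The cusp span** `I_{ℤ·g}·U ⊔ ⨆_{x ≠ ε⁰} ⟨ivec_x⟩ ⊆ U = 𝔽_l[E_F[l]]`: the `U`-part of
`I_{ε′} · I_{ε″} · Ker(Δ_X̲ ↠ Δ_ε)` at the model. [cite: Mochizuki2012, IUTchI §1 p.37] -/
def cuspSpan : Subgroup (U E Fbar l) :=
  cob g ⊔ ⨆ x : {x : Tors E Fbar l ⧸ Subgroup.zpowers g // x ≠ 1}, Subgroup.zpowers (ivec s h x.1)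

/-- [cite: Mochizuki2012, IUTchI §1 p.37] -/
theorem cob_le_cuspSpan : cob g ≤ cuspSpan s h := le_sup_left

/-- [cite: Mochizuki2012, IUTchI §1 p.37] -/
theorem ivec_mem_cuspSpan_of_ne {x : Tors E Fbar l ⧸ Subgroup.zpowers g} (hx : x ≠ 1) : ivec s h x ∈ cuspSpan s h :=
  Subgroup.mem_sup_right
    (le_iSup (fun x : {x : Tors E Fbar l ⧸ Subgroup.zpowers g // x ≠ 1} => Subgroup.zpowers (ivec s h x.1)) ⟨x, hx⟩
      (Subgroup.mem_zpowers _))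

variable {s} (hs : ∀ q : Tors E Fbar l ⧸ Subgroup.zpowers g, (QuotientGroup.mk (s q) : _ ⧸ Subgroup.zpowers g) = q)
include hs

/-- `e_{s(x)·t} ≡ e_{s(x·[t])}` modulo `I_{ℤ·g}·U` (both points lie over the cusp `x·[t]`). [cite: Mochizuki2012, IUTchI §1 p.37] -/
theorem e_s_mul_mul_inv_mem_cob (x : Tors E Fbar l ⧸ Subgroup.zpowers g) (t : Tors E Fbar l) :
    U.e (s x * t) * (U.e (s (x * QuotientGroup.mk t)))⁻¹ ∈ cob (E := E) (Fbar := Fbar) g := by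
  have hk : (s (x * QuotientGroup.mk t))⁻¹ * (s x * t) ∈ Subgroup.zpowers g := by
    rw [← QuotientGroup.eq_one_iff, QuotientGroup.mk_mul, QuotientGroup.mk_inv, QuotientGroup.mk_mul, hs, hs,
      inv_mul_cancel]
  have := e_mul_inv_e_mem_cob (E := E) (Fbar := Fbar) hk (s (x * QuotientGroup.mk t))
  rwa [mul_inv_cancel_left] at this

/-- **THE ONE RELATION among the `l` cusp classes**: `Π_x ivec_x ∈ I_{ℤ·g}·U` — in the `ℤ·g`-coinvariants
`e_{s(x)h} ≡ e_{s(x[h])}`, `e_{s(x)h⁻¹} ≡ e_{s(x[h]⁻¹)}`, and both products are re-indexings of `Π_x e_{s(x)}` (print: the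
natural exact sequence, i.e. ONE relation `Σ = 0` among the cusps of `X̲`). [cite: Mochizuki2012, IUTchI §1 p.37] -/
theorem prod_ivec_mem_cob [Fintype (Tors E Fbar l ⧸ Subgroup.zpowers g)] :
    (∏ x, ivec s h x) ∈ cob (E := E) (Fbar := Fbar) g := by
  let φ := QuotientGroup.mk' (cob (E := E) (Fbar := Fbar) g)
  rw [← QuotientGroup.eq_one_iff, show (QuotientGroup.mk (∏ x, ivec s h x) : U E Fbar l ⧸ cob g) = φ (∏ x, ivec s h x)
    from rfl, map_prod]
  have h1 : ∀ x : Tors E Fbar l ⧸ Subgroup.zpowers g, φ (ivec s h x) =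
      φ (U.e (s (x * QuotientGroup.mk h))) * (φ (U.e (s (x * (QuotientGroup.mk h)⁻¹))))⁻¹ := fun x => by
    rw [ivec, map_mul, map_inv]
    congr 1
    · rw [eq_comm, QuotientGroup.mk'_eq_mk']
      exact ⟨U.e (s x * h) * (U.e (s (x * QuotientGroup.mk h)))⁻¹, e_s_mul_mul_inv_mem_cob hs x h,
        by rw [mul_comm, inv_mul_cancel_right]⟩
    · rw [eq_comm, inv_inj, QuotientGroup.mk'_eq_mk', ← QuotientGroup.mk_inv]
      exact ⟨U.e (s x * h⁻¹) * (U.e (s (x * QuotientGroup.mk h⁻¹)))⁻¹, e_s_mul_mul_inv_mem_cob hs x h⁻¹,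
        by rw [mul_comm, inv_mul_cancel_right]⟩
  simp_rw [h1]
  rw [Finset.prod_mul_distrib, Finset.prod_inv_distrib,
    Fintype.prod_equiv (Equiv.mulRight (QuotientGroup.mk h : _ ⧸ Subgroup.zpowers g))
      (fun x => φ (U.e (s (x * QuotientGroup.mk h)))) (fun x => φ (U.e (s x))) (fun _ => rfl),
    Fintype.prod_equiv (Equiv.mulRight ((QuotientGroup.mk h : _ ⧸ Subgroup.zpowers g)⁻¹))
      (fun x => φ (U.e (s (x * (QuotientGroup.mk h)⁻¹)))) (fun x => φ (U.e (s x))) (fun _ => rfl),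
    mul_inv_cancel]

variable [E.IsElliptic] [NeZero l]

/-- `ivec_x ∈ cuspSpan` for EVERY cusp `x` — including `ε⁰`, by the one relation. [cite: Mochizuki2012, IUTchI §1 p.37] -/
theorem ivec_mem_cuspSpan (x : Tors E Fbar l ⧸ Subgroup.zpowers g) : ivec s h x ∈ cuspSpan s h := by
  by_cases hx : x = 1
  · subst hx
    haveI := Fintype.ofFinite (Tors E Fbar l ⧸ Subgroup.zpowers g)
    have hrel := prod_ivec_mem_cob h hs
    rw [← Finset.mul_prod_erase Finset.univ (ivec s h) (Finset.mem_univ 1)] at hrel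
    have hrest : (∏ x ∈ Finset.univ.erase (1 : Tors E Fbar l ⧸ Subgroup.zpowers g), ivec s h x) ∈ cuspSpan s h :=
      Subgroup.prod_mem _ fun x hx => ivec_mem_cuspSpan_of_ne s h (Finset.ne_of_mem_erase hx)
    have := Subgroup.mul_mem _ (cob_le_cuspSpan s h hrel) (Subgroup.inv_mem _ hrest)
    rwa [mul_inv_cancel_right] at this
  · exact ivec_mem_cuspSpan_of_ne s h hx

/-- Every inertia vector `v_b = e_{bh}·e_{bh⁻¹}⁻¹` lies in the cusp span (`v_b = τ_k ivec_{[b]}`, `k ∈ ℤ·g`).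
[cite: Mochizuki2012, IUTchI §1 p.37] -/
theorem ivecAt_mem_cuspSpan (b : Tors E Fbar l) : ivecAt h b ∈ cuspSpan s h := by
  have hk : (s (QuotientGroup.mk b))⁻¹ * b ∈ Subgroup.zpowers g := by
    rw [← QuotientGroup.eq_one_iff, QuotientGroup.mk_mul, QuotientGroup.mk_inv, hs, inv_mul_cancel]
  have e : ivecAt h b = transl E Fbar l ((s (QuotientGroup.mk b))⁻¹ * b) (ivec s h (QuotientGroup.mk b)) *
      (ivec s h (QuotientGroup.mk b))⁻¹ * ivec s h (QuotientGroup.mk b) := by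
    rw [inv_mul_cancel_right, ivec_eq_ivecAt, transl_ivecAt, mul_inv_cancel_left]
  rw [e]
  exact Subgroup.mul_mem _ (cob_le_cuspSpan s h (transl_mul_inv_mem_cob hk _)) (ivec_mem_cuspSpan h hs _)

/-- `e_{P·a} · e_P⁻¹ ∈ cuspSpan` (`= v_{Ph}`, `h² = a`). [cite: Mochizuki2012, IUTchI §1 p.37] -/
theorem e_mul_a_mul_inv_e_mem_cuspSpan {a : Tors E Fbar l} (hh : h ^ 2 = a) (P : Tors E Fbar l) :
    U.e (P * a) * (U.e P)⁻¹ ∈ cuspSpan s h := by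
  have := ivecAt_mem_cuspSpan h hs (P * h)
  rwa [ivecAt, mul_assoc, ← pow_two, hh, mul_inv_cancel_right] at this

/-- `e_{P·aⁿ} · e_P⁻¹ ∈ cuspSpan`. [cite: Mochizuki2012, IUTchI §1 p.37] -/
theorem e_mul_pow_mul_inv_e_mem_cuspSpan {a : Tors E Fbar l} (hh : h ^ 2 = a) (P : Tors E Fbar l) (n : ℕ) :
    U.e (P * a ^ n) * (U.e P)⁻¹ ∈ cuspSpan s h := by
  induction n with
  | zero => rw [pow_zero, mul_one, mul_inv_cancel]; exact one_mem _
  | succ n ih =>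
    have := Subgroup.mul_mem _ (e_mul_a_mul_inv_e_mem_cuspSpan h hs hh (P * a ^ n)) ih
    rwa [mul_assoc (U.e (P * a ^ n * a)), inv_mul_cancel_left, mul_assoc P, ← pow_succ] at this

/-- **`e_P · e_Q⁻¹ ∈ cuspSpan` for all `P, Q ∈ E_F[l]`** (`E_F[l] = ⟨a⟩ · ℤ·g` since `[a]` generates the prime-order
`E_F[l]/ℤ·g`). [cite: Mochizuki2012, IUTchI §1 p.37] -/
theorem e_mul_inv_e_mem_cuspSpan {a : Tors E Fbar l} (hl : l.Prime) (hg : g ≠ 1)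
    (hcard : Nat.card (Tors E Fbar l) = l ^ 2) (ha : a ∉ Subgroup.zpowers g) (hh : h ^ 2 = a) (P Q : Tors E Fbar l) :
    U.e P * (U.e Q)⁻¹ ∈ cuspSpan s h := by
  haveI : Fact l.Prime := ⟨hl⟩
  have habar : (QuotientGroup.mk a : _ ⧸ Subgroup.zpowers g) ≠ 1 := fun h1 => ha ((QuotientGroup.eq_one_iff a).mp h1)
  have hcardQ : Nat.card (Tors E Fbar l ⧸ Subgroup.zpowers g) = l := by
    have h1 := (Subgroup.zpowers g).card_mul_index
    rw [Tors.card_zpowers hl hg, hcard, sq, Subgroup.index] at h1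
    exact Nat.eq_of_mul_eq_mul_left hl.pos h1
  -- `e_P · e_1⁻¹ ∈ cuspSpan` for every `P = aⁿ k`, `k ∈ ℤ·g`
  have key : ∀ P : Tors E Fbar l, U.e P * (U.e 1)⁻¹ ∈ cuspSpan s h := fun P => by
    obtain ⟨n, hn⟩ := (Submonoid.mem_powers_iff _ _).mp
      (mem_powers_of_prime_card hcardQ habar (g' := (QuotientGroup.mk P : _ ⧸ Subgroup.zpowers g)))
    have hk : (a ^ n)⁻¹ * P ∈ Subgroup.zpowers g := by
      rw [← QuotientGroup.eq_one_iff, QuotientGroup.mk_mul, QuotientGroup.mk_inv, QuotientGroup.mk_pow, hn,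
        inv_mul_cancel]
    have h1 := e_mul_inv_e_mem_cob (E := E) (Fbar := Fbar) hk (a ^ n)
    rw [mul_inv_cancel_left] at h1
    have h2 := e_mul_pow_mul_inv_e_mem_cuspSpan h hs hh 1 n
    rw [one_mul] at h2
    have := Subgroup.mul_mem _ (cob_le_cuspSpan s h h1) h2
    rwa [mul_assoc, inv_mul_cancel_left] at this
  have := Subgroup.mul_mem _ (key P) (Subgroup.inv_mem _ (key Q))
  rwa [mul_inv_rev, inv_inv, mul_assoc, inv_mul_cancel_left] at this

omit hs in
/-! ## The total augmentation `ε(w) = Σ_P w(P)` -/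

/-- The finite set of all of `E_F[l](F̄)`. [cite: Mochizuki2012, IUTchI Def 3.1 (c) p.62] -/
def totFinset : Finset (Tors E Fbar l) := (Set.finite_univ : (Set.univ : Set (Tors E Fbar l)).Finite).toFinset

omit hs in
/-- [cite: Mochizuki2012, IUTchI Def 3.1 (c) p.62] -/
theorem mem_totFinset (P : Tors E Fbar l) : P ∈ totFinset (E := E) (Fbar := Fbar) (l := l) := by
  rw [totFinset, Set.Finite.mem_toFinset]; exact Set.mem_univ _

/-- **The total augmentation** `ε : (E_F[l] → 𝔽_l) →+ 𝔽_l`, `w ↦ Σ_P w(P)`. [cite: Mochizuki2012, IUTchI §1 p.37] -/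
def totSum : (Tors E Fbar l → ZMod l) →+ ZMod l :=
  ∑ P ∈ totFinset (E := E) (Fbar := Fbar) (l := l), Pi.evalAddMonoidHom (fun _ => ZMod l) P

omit hs in
/-- [cite: Mochizuki2012, IUTchI §1 p.37] -/
theorem totSum_apply (w : Tors E Fbar l → ZMod l) :
    totSum (E := E) w = ∑ P ∈ totFinset (E := E) (Fbar := Fbar) (l := l), w P := by
  rw [totSum, AddMonoidHom.finsetSum_apply]; rfl

omit hs in
/-- `ε(e_P) = 1`. [cite: Mochizuki2012, IUTchI §1 p.37] -/
theorem totSum_e (P : Tors E Fbar l) : totSum (E := E) (Multiplicative.toAdd (U.e P)) = 1 := by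
  rw [totSum_apply]
  simp_rw [U.toAdd_e_apply]
  rw [Finset.sum_ite_eq', if_pos (mem_totFinset P)]

omit hs in
/-- `ε(τ_t w) = ε(w)`. [cite: Mochizuki2012, IUTchI §1 p.37] -/
theorem totSum_transl (t : Tors E Fbar l) (w : U E Fbar l) :
    totSum (E := E) (Multiplicative.toAdd (transl E Fbar l t w)) = totSum (E := E) (Multiplicative.toAdd w) := by
  rw [totSum_apply, totSum_apply]
  exact Finset.sum_nbij' (· * t⁻¹) (· * t) (fun k _ => mem_totFinset _) (fun k _ => mem_totFinset _) (fun k _ => by simp)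
    (fun k _ => by simp) (fun k _ => by rw [toAdd_transl_apply])

omit hs in
/-- `ε((1,u)·w) = ε(u)·ε(w)` (the sign of the involution). [cite: Mochizuki2012, IUTchI §1 p.38] -/
theorem totSum_outU_inr (u : ℤˣ) (w : U E Fbar l) : totSum (E := E) (Multiplicative.toAdd (outU E l (1, u) w)) =
    ((u : ℤ) : ZMod l) * totSum (E := E) (Multiplicative.toAdd w) := by
  rw [totSum_apply, totSum_apply, Finset.mul_sum]
  refine Finset.sum_nbij' (· ^ (u : ℤ)) (· ^ (u : ℤ)) (fun k _ => mem_totFinset _) (fun k _ => mem_totFinset _)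
    (fun k _ => ?_) (fun k _ => ?_) (fun k _ => by rw [toAdd_outU_apply, act_inr_symm_apply]; rfl)
  all_goals rw [← zpow_mul, ← Units.val_mul, Int.units_mul_self, Units.val_one, zpow_one]

omit hs in
/-- `ε` vanishes on `I_{ℤ·g}·U`. [cite: Mochizuki2012, IUTchI §1 p.37] -/
theorem totSum_eq_zero_of_mem_cob {w : U E Fbar l} (hw : w ∈ cob g) : totSum (E := E) (Multiplicative.toAdd w) = 0 := by
  unfold cob at hw
  induction hw using Subgroup.closure_induction with
  | mem w hw =>
    obtain ⟨t, -, f, rfl⟩ := hw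
    rw [toAdd_mul, toAdd_inv, map_add, map_neg, totSum_transl, add_neg_cancel]
  | one => rw [toAdd_one, map_zero]
  | mul x y _ _ hx hy => rw [toAdd_mul, map_add, hx, hy, add_zero]
  | inv x _ hx => rw [toAdd_inv, map_neg, hx, neg_zero]

omit hs in
/-- `ε(ivec_x) = 1 − 1 = 0`. [cite: Mochizuki2012, IUTchI §1 p.37] -/
theorem totSum_ivec (x : Tors E Fbar l ⧸ Subgroup.zpowers g) :
    totSum (E := E) (Multiplicative.toAdd (ivec s h x)) = 0 := by
  rw [ivec, toAdd_mul, toAdd_inv, map_add, map_neg, totSum_e, totSum_e, add_neg_cancel]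

omit hs in
/-- `ε` vanishes on the cusp span. [cite: Mochizuki2012, IUTchI §1 p.37] -/
theorem totSum_eq_zero_of_mem_cuspSpan {w : U E Fbar l} (hw : w ∈ cuspSpan s h) :
    totSum (E := E) (Multiplicative.toAdd w) = 0 := by
  obtain ⟨y, hy, z, hz, rfl⟩ := Subgroup.mem_sup.mp hw
  rw [toAdd_mul, map_add, totSum_eq_zero_of_mem_cob hy, zero_add]
  refine Subgroup.iSup_induction _ (C := fun z => totSum (E := E) (Multiplicative.toAdd z) = 0) hz
    (fun i z hz => ?_) (by rw [toAdd_one, map_zero]) (fun x y hx hy => by rw [toAdd_mul, map_add, hx, hy, add_zero])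
  obtain ⟨n, rfl⟩ := Subgroup.mem_zpowers_iff.mp hz
  rw [toAdd_zpow, map_zsmul, totSum_ivec, smul_zero]

/-- **`Ker ε ⊆ cuspSpan`**: a `w ∈ U` with total augmentation `0` lies in the cusp span.  Every `w` is `≡ e_1^k` modulo
`cuspSpan` (basis induction with `e_P ≡ e_1`), and `ε(e_1^k) = k`. [cite: Mochizuki2012, IUTchI §1 p.37] -/
theorem mem_cuspSpan_of_totSum_eq_zero {a : Tors E Fbar l} (hl : l.Prime) (hg : g ≠ 1)
    (hcard : Nat.card (Tors E Fbar l) = l ^ 2) (ha : a ∉ Subgroup.zpowers g) (hh : h ^ 2 = a) {w : U E Fbar l}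
    (hw : totSum (E := E) (Multiplicative.toAdd w) = 0) : w ∈ cuspSpan s h := by
  -- every `w` lies in `cuspSpan ⊔ ⟨e_1⟩`
  have hall : ∀ w : U E Fbar l, w ∈ cuspSpan s h ⊔ Subgroup.zpowers (U.e 1) := fun w => by
    refine Pi.single_induction (M := fun _ : Tors E Fbar l => ZMod l)
      (fun f => (Multiplicative.ofAdd f : U E Fbar l) ∈ cuspSpan s h ⊔ Subgroup.zpowers (U.e 1))
      (Multiplicative.toAdd w) (by rw [ofAdd_zero]; exact one_mem _)
      (fun f f' hf hf' => by rw [ofAdd_add]; exact mul_mem hf hf') (fun P m => ?_)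
    have e1 : (Multiplicative.ofAdd (Pi.single P m) : U E Fbar l) = U.e P ^ (m.val : ℤ) := by
      refine U.ext fun Q => ?_
      rw [toAdd_ofAdd, toAdd_zpow, Pi.smul_apply, U.toAdd_e_apply, Pi.single_apply, smul_ite, smul_zero,
        zsmul_eq_mul, mul_one, Int.cast_natCast, ZMod.natCast_zmod_val]
    rw [e1, show U.e P ^ (m.val : ℤ) = (U.e P * (U.e 1)⁻¹) ^ (m.val : ℤ) * U.e 1 ^ (m.val : ℤ) by
      rw [← mul_zpow, inv_mul_cancel_right]]
    exact mul_mem (Subgroup.mem_sup_left (Subgroup.zpow_mem _ (e_mul_inv_e_mem_cuspSpan h hs hl hg hcard ha hh P 1) _))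
      (Subgroup.mem_sup_right (Subgroup.zpow_mem _ (Subgroup.mem_zpowers _) _))
  obtain ⟨y, hy, z, hz, rfl⟩ := Subgroup.mem_sup.mp (hall w)
  obtain ⟨k, rfl⟩ := Subgroup.mem_zpowers_iff.mp hz
  rw [toAdd_mul, map_add, totSum_eq_zero_of_mem_cuspSpan h hy, zero_add, toAdd_zpow, map_zsmul, totSum_e,
    zsmul_eq_mul, mul_one] at hw
  rw [U.zpow_eq_one_of_cast_eq_zero _ hw, mul_one]
  exact hy

end TorsionCuspModel

end Literature.IUT.HodgeTheaters

end
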